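import Literature.AnabelianGeometry.EtaleTheta.Discharge.Sec2Cor219iiiLevelCompatOfHearts
import Literature.AnabelianGeometry.EtaleTheta.Discharge.Sec2Cor219iiiOfConstConjugator
import HarnessLib

/-!
# [EtTh] Cor. 2.19 (iii), tower form — (b2) part 3: a COMPATIBLE CHOICE of heart exponents across the levels (compactness)
# and the LEVEL-DEPENDENT knit «Cor. 2.19 (iii) from point-hearts with exponents ∃ m per level» (proof-only, generic)

S. Mochizuki, *The étale theta function and its Frobenioid-theoretic manifestations*, Publ. RIMS **45** (2009) [EtTh],
§2, Cor. 2.19 (iii), PRIMS PDF p. 65 («by taking a compatible system of members of the above collections of classes»,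
l. 36 of p. 65 in the PRIMS render); Cor. 2.19 (ii) p. 64
(«`E` cofinal, totally ordered») [cite: MochizukiEtTh2009, Cor 2.19(iii) p.65].

Cell `abc-iut`, seat abc-iut-f-142 (gen 6), K-L6 row «COR219III-M1b», slice (b2) = roadmap M2, sequel of p491632 / p492018.
CONTEXT (abc-iut-w5-d162 gen 9, 03:29:16Z): at the Tate model a CONSTANT conjugator `w` (abc-iut-L1-t6's
`cor219_iii_of_const_conjugator_of_origin`, p490284) is NOT available for a general admissible `γ` (profinite-inner `Ad(â^u)`,
`u ∈ l·Ẑ ∖ l·ℤ`), so abc-iut-C-hgal-2's LEVEL-DEPENDENT knit `cor219_iii_of_hearts_of_origin` (p482618, points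
`x : E → Π^tp_X̲̲`) is the route; its clause (b2) needs the exponents `m_M` of `x M := a^{m_M}` COMPATIBLE mod `M`, while a
level-`M` heart at the point `b` pins `m_M` only modulo the order of `red_M θ⁅a⁻¹,b⁆`, which is `< M` at even `M` (p487040).
PROOF-ONLY: no definition, no instance, no notation, no new named fact; GENERIC over every §1 setting, `X̲̲`-choice, tower;
p482618, p490284 (`heart_of_value_at'`), this lineage's `exists_transport` / `uniqueness_on_DeltaP_of_dense` /
`conjRoot_zpow_eq_comm_zpow_mul` / `red_conjRoot_pow_eq_of_sq` / `red_conjRoot_zpow_eq_of_modEq` consumed BY NAME.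

WHAT IS SHOWN.
* §1 The value identity «`red_M v = red_M (conjRoot (a^m) f b̃)`» at a GEOMETRIC point `b` is PERIODIC in `m` mod `M`
  (`red_conjRoot_zpow_point_eq_of_modEq`: at a geometric point `conjRoot (a^m) f b̃ = θ⁅a⁻¹,b⁆^m·f(b̃)` and `μ_M` has exponent
  `M` — no parity, no squares) and STABLE under pushing down a level (`red_eq_red_of_dvd`, `τ.red_mod`).
* §2 **`exists_compatible_exponents` (COMPATIBLE CHOICE).**  If at every level `M ∈ E` SOME exponent satisfies the value
  identity, then there is a family `m : E → ℤ` satisfying it at every level AND `m M′ ≡ m M (mod M)` whenever `M ∣ M′`.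
  Cantor's intersection theorem in the compact space `Π_{M ∈ E} Fin M`: the level sets «`x_M` is a level-`M` exponent and
  `x_N = x_M mod N` for `N ∣ M`» are closed (discrete factors), nonempty (§1), decreasing along divisibility, and `E` is totally
  ordered (`CyclotomeTower.total`) — `IsCompact.nonempty_iInter_of_directed_nonempty_isCompact_isClosed`.  No `hgen`, any parity.
* §3 (b2) at EVERY pair `M ∣ M′` from a compatible family: under the squares hypothesis on geometric commutators
  (`red_conjRoot_zpow_eq_of_modEq_of_sq`, `levelCompat_of_compatible_of_sq`; at the Tate model the hypothesis is p487040's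
  `exists_sq_eq_toTheta_comm_modelχq`), and without it at pairs with odd lower level (`levelCompat_of_compatible_of_odd`).
* §4 **THE LEVEL-DEPENDENT KNIT** `cor219_iii_of_pointHearts_of_sq_of_origin`: abc-iut-L1-t6's p490284 theorem with the
  constant-`w` value clause REPLACED by the weaker «for every `γ̃` some root cocycle `f₀` with, at EVERY level `M`, SOME power
  `a^m` of the fixed geometric `a` satisfying `red_M (γ̃⁻¹ f₀(γ b̃)) = red_M (conjRoot (a^m) f₀ b̃)`» — exponent free to depend
  on `M`, NO compatibility asked — plus `b` geometric, `θ⁅a⁻¹,b⁆ ∈ l·Δ_Θ` and the squares hypothesis; CONCLUSION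
  `T.Cor219_iii`.  (At the Tate datum this ∃-clause is the shape of the row «COR219III-M1b-EVEN (β)»'s (β2), abc-iut-w5-d162.)

HONEST FRAMING: unconditional statements about OUR typed objects over an arbitrary §1 setting; the model facts quoted are
binder-discharge evidence about OUR semi-synthetic model, not statements of print; nothing of [EtTh] (refereed) is asserted
beyond what is proved; no side is taken on [IUTchIII] Cor. 3.12 or on any author; typed ≠ proved; nothing here asserts abc
proved or refuted.
-/

noncomputable section

namespace Literature.AnabelianGeometry.EtaleTheta

open Literature.AnabelianGeometry.SemiGraphs
open scoped IsMulCommutative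

namespace ThetaSetting.EtaleThetaData.DoubleUnderline

variable {p : ℕ} [Fact p.Prime] {D : ThetaSetting p} {E : D.EtaleThetaData} {l : ℕ}
  (C : E.DoubleUnderline l) {Es : Set ℕ+} (τ : D.CyclotomeTower l Es)

/-! ## §1. The value identity at a geometric point: periodic mod `M`, stable under pushing down a level -/

/-- **Periodicity mod `M` at a geometric point.**  For a root cocycle `f`, geometric `a ∈ Π^tp_X̲̲` and `b ∈ Π^tp_Ÿ̲̲` with
`θ⁅a⁻¹,b⁆ ∈ l·Δ_Θ`: `m ≡ m′ (mod M)` ⇒ `red_M (conjRoot (a^m) f b̃) = red_M (conjRoot (a^{m′}) f b̃)` — by the split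
`conjRoot (a^m) f b̃ = θ⁅a⁻¹,b⁆^m·f(b̃)` in `l·Δ_Θ` (`conjRoot_zpow_eq_comm_zpow_mul`) and `ζ^M = 1` in `μ_M` (`card_MuN`).
No parity and no squares are needed AT A GEOMETRIC POINT. [cite: MochizukiEtTh2009, Cor 2.19(iii) p.65] -/
theorem red_conjRoot_zpow_point_eq_of_modEq (hC : D.Compat) (hS : D.Sec2Hyps) (h15 : Prop15iii E hC)
    {f : contCocycles D.toTheta D.DeltaTheta C.GtpYdduu} (hf : f ∈ C.rootCocycles hC)
    (a : C.Huu) (ha : D.aug.toMonoidHom (a : D.PiTemp) = 1)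
    (b : (C.thetaEnvTower τ hC hS).PiYdd) (hb : D.aug.toMonoidHom ((b : C.Huu) : D.PiTemp) = 1)
    (h₁ : D.toTheta (((a : D.PiTemp))⁻¹ * ((b : C.Huu) : D.PiTemp) * (a : D.PiTemp) * (((b : C.Huu) : D.PiTemp))⁻¹) ∈
      D.lDeltaTheta l) (M : Es) {m m' : ℤ} (hmm' : m ≡ m' [ZMOD ((M : ℕ+) : ℕ)]) :
    (τ.mod M).red ⟨(C.conjRoot hC (a ^ m) f.1 (C.inclYdduu b) : D.GtpTheta), (D.lDeltaTheta_normal l).conj_mem _ (hf.1 _) _⟩ =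
      (τ.mod M).red ⟨(C.conjRoot hC (a ^ m') f.1 (C.inclYdduu b) : D.GtpTheta),
        (D.lDeltaTheta_normal l).conj_mem _ (hf.1 _) _⟩ := by
  rw [C.conjRoot_zpow_eq_comm_zpow_mul τ hC hS h15 hf a ha b hb h₁ m, C.conjRoot_zpow_eq_comm_zpow_mul τ hC hS h15 hf a ha b hb h₁ m',
    map_mul (τ.mod M).red, map_mul (τ.mod M).red, map_zpow (τ.mod M).red, map_zpow (τ.mod M).red]
  congr 1
  obtain ⟨t, ht⟩ := Int.modEq_iff_dvd.1 hmm'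
  have hm' : m' = m + (((M : ℕ+) : ℕ) : ℤ) * t := by omega
  have hζ : ((τ.mod M).red ⟨_, h₁⟩) ^ ((M : ℕ+) : ℕ) = 1 := by
    have h := pow_card_eq_one (G := MuN p (M : ℕ+)) (x := (τ.mod M).red ⟨_, h₁⟩)
    rwa [card_MuN] at h
  rw [hm', zpow_add, zpow_mul, zpow_natCast, hζ, one_zpow, mul_one]

/-- Pushing an identity of reductions down a level: `red_{M′} x = red_{M′} y` and `M ∣ M′` give `red_M x = red_M y`
(`CyclotomeTower.red_mod`). [cite: MochizukiEtTh2009, Cor 2.19 (ii) p.64] -/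
theorem red_eq_red_of_dvd {M M' : Es} (h : (M : ℕ+) ∣ M') {x y : D.lDeltaTheta l}
    (hxy : (τ.mod M').red x = (τ.mod M').red y) : (τ.mod M).red x = (τ.mod M).red y := by
  have h' := congrArg (MuN.red p (M : ℕ+) (M' : ℕ+) (pnat_dvd h)) hxy
  rwa [τ.red_mod, τ.red_mod] at h'

/-! ## §2. A compatible choice of exponents (Cantor intersection over the levels) -/

/-- **A COMPATIBLE CHOICE OF HEART EXPONENTS (compactness).**  Over ANY §1 setting and tower: let `f` be a root cocycle,
`a ∈ Π^tp_X̲̲` and `b ∈ Π^tp_Ÿ̲̲` geometric with `θ⁅a⁻¹,b⁆ ∈ l·Δ_Θ`, and `v ∈ l·Δ_Θ`.  If at EVERY level `M ∈ E` SOME exponent `m`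
satisfies the value identity `red_M v = red_M (conjRoot (a^m) f b̃)`, then there is a family `m : E → ℤ` satisfying it at
every level with `m M′ ≡ m M (mod M)` for all `M ∣ M′` in `E`.  PROOF: Cantor's intersection theorem
(`IsCompact.nonempty_iInter_of_directed_nonempty_isCompact_isClosed`) in the compact space `Π_{M ∈ E} Fin M` applied to the level
sets `S_M :=` «`x_M` is a level-`M` exponent ∧ `x_N = x_M mod N` for every `N ∣ M` in `E`»: closed (discrete factors), nonempty
(reduce a level-`M` exponent; periodicity §1), `S_{M′} ⊆ S_M` for `M ∣ M′` (level-down §1 + periodicity), directed because `E` is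
totally ordered by divisibility (`CyclotomeTower.total`).  No generator hypothesis, any parity.
[cite: MochizukiEtTh2009, Cor 2.19(iii) p.65] -/
theorem exists_compatible_exponents (hC : D.Compat) (hS : D.Sec2Hyps) (h15 : Prop15iii E hC)
    {f : contCocycles D.toTheta D.DeltaTheta C.GtpYdduu} (hf : f ∈ C.rootCocycles hC)
    (a : C.Huu) (ha : D.aug.toMonoidHom (a : D.PiTemp) = 1)
    (b : (C.thetaEnvTower τ hC hS).PiYdd) (hb : D.aug.toMonoidHom ((b : C.Huu) : D.PiTemp) = 1)
    (h₁ : D.toTheta (((a : D.PiTemp))⁻¹ * ((b : C.Huu) : D.PiTemp) * (a : D.PiTemp) * (((b : C.Huu) : D.PiTemp))⁻¹) ∈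
      D.lDeltaTheta l)
    (v : D.lDeltaTheta l)
    (hex : ∀ M : Es, ∃ m : ℤ, (τ.mod M).red v =
      (τ.mod M).red ⟨(C.conjRoot hC (a ^ m) f.1 (C.inclYdduu b) : D.GtpTheta),
        (D.lDeltaTheta_normal l).conj_mem _ (hf.1 _) _⟩) :
    ∃ m : Es → ℤ, (∀ M : Es, (τ.mod M).red v =
        (τ.mod M).red ⟨(C.conjRoot hC (a ^ m M) f.1 (C.inclYdduu b) : D.GtpTheta),
          (D.lDeltaTheta_normal l).conj_mem _ (hf.1 _) _⟩) ∧
      ∀ M M' : Es, ((M : ℕ+) ∣ M') → m M' ≡ m M [ZMOD ((M : ℕ+) : ℕ)] := by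
  classical
  haveI : Nonempty Es := ⟨⟨1, τ.one_mem⟩⟩
  -- the value identity at `b` with exponent `m`, as a predicate; periodic mod `M`, stable under level-down
  set V : ∀ M : Es, ℤ → Prop := fun M m => (τ.mod M).red v =
      (τ.mod M).red ⟨(C.conjRoot hC (a ^ m) f.1 (C.inclYdduu b) : D.GtpTheta),
        (D.lDeltaTheta_normal l).conj_mem _ (hf.1 _) _⟩ with hV
  have hVper : ∀ (M : Es) {m m' : ℤ}, m ≡ m' [ZMOD ((M : ℕ+) : ℕ)] → V M m → V M m' := by
    intro M m m' hmm' hm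
    simp only [hV] at hm ⊢
    rw [hm]
    exact C.red_conjRoot_zpow_point_eq_of_modEq τ hC hS h15 hf a ha b hb h₁ M hmm'
  have hVdown : ∀ {M M' : Es} (m : ℤ), ((M : ℕ+) ∣ M') → V M' m → V M m := by
    intro M M' m hMM' hm
    simp only [hV] at hm ⊢
    exact red_eq_red_of_dvd τ hMM' hm
  -- the level sets in the compact space `Π_{M ∈ E} Fin M`
  set S : Es → Set (∀ M : Es, Fin ((M : ℕ+) : ℕ)) := fun M =>
    ((fun x => x M) ⁻¹' {r | V M ((r : ℕ) : ℤ)}) ∩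
      ⋂ N : Es, (fun x => (x N, x M)) ⁻¹' {q | ((N : ℕ+) ∣ M) → ((q.1 : ℕ)) = (q.2 : ℕ) % ((N : ℕ+) : ℕ)} with hS_def
  have hmemS : ∀ (M : Es) (x : ∀ M : Es, Fin ((M : ℕ+) : ℕ)), x ∈ S M ↔
      V M ((x M : ℕ) : ℤ) ∧ ∀ N : Es, ((N : ℕ+) ∣ M) → ((x N : ℕ)) = (x M : ℕ) % ((N : ℕ+) : ℕ) := by
    intro M x
    simp only [hS_def, Set.mem_inter_iff, Set.mem_preimage, Set.mem_setOf_eq, Set.mem_iInter]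
  have hclosed : ∀ M : Es, IsClosed (S M) := by
    intro M
    refine IsClosed.inter ((isClosed_discrete _).preimage (continuous_apply M)) (isClosed_iInter fun N => ?_)
    exact (isClosed_discrete _).preimage ((continuous_apply N).prodMk (continuous_apply M))
  have hne : ∀ M : Es, (S M).Nonempty := by
    intro M
    obtain ⟨m, hm⟩ := hex M
    have hM0 : (0 : ℤ) < (((M : ℕ+) : ℕ) : ℤ) := by exact_mod_cast (M : ℕ+).pos
    set r : ℕ := (m % (((M : ℕ+) : ℕ) : ℤ)).toNat with hr
    have hrz : (r : ℤ) = m % (((M : ℕ+) : ℕ) : ℤ) := Int.toNat_of_nonneg (Int.emod_nonneg _ hM0.ne')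
    have hrlt : r < ((M : ℕ+) : ℕ) := by
      have h := Int.emod_lt_of_pos m hM0
      omega
    refine ⟨fun N => ⟨r % ((N : ℕ+) : ℕ), Nat.mod_lt _ (N : ℕ+).pos⟩, (hmemS M _).2 ⟨?_, fun N hNM => ?_⟩⟩
    · -- `V M (r % M) = V M r ⟸ V M m`
      have hrM : (r % ((M : ℕ+) : ℕ) : ℕ) = r := Nat.mod_eq_of_lt hrlt
      simp only [hrM]
      refine hVper M ?_ hm
      rw [Int.ModEq, hrz, Int.emod_emod_of_dvd _ (dvd_refl _)]
    · simp only
      rw [Nat.mod_mod_of_dvd r (pnat_dvd hNM)]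
  have hmono : ∀ {M M' : Es}, ((M : ℕ+) ∣ M') → S M' ⊆ S M := by
    intro M M' hMM' x hx
    obtain ⟨hxV, hxN⟩ := (hmemS M' x).1 hx
    have hxM : ((x M : ℕ)) = (x M' : ℕ) % ((M : ℕ+) : ℕ) := hxN M hMM'
    refine (hmemS M x).2 ⟨?_, fun N hNM => ?_⟩
    · rw [hxM]
      refine hVper M ?_ (hVdown _ hMM' hxV)
      rw [Int.ModEq, Int.natCast_mod, Int.emod_emod_of_dvd _ (dvd_refl _)]
    · rw [hxN N (hNM.trans hMM'), hxM, Nat.mod_mod_of_dvd _ (pnat_dvd hNM)]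
  have hdir : Directed (· ⊇ ·) S := by
    intro M₁ M₂
    rcases τ.total (M₁ : ℕ+) M₁.2 (M₂ : ℕ+) M₂.2 with h | h
    · exact ⟨M₂, hmono h, le_rfl⟩
    · exact ⟨M₁, le_rfl, hmono h⟩
  obtain ⟨x, hx⟩ := IsCompact.nonempty_iInter_of_directed_nonempty_isCompact_isClosed S hdir hne
    (fun M => (hclosed M).isCompact) hclosed
  rw [Set.mem_iInter] at hx
  refine ⟨fun M => ((x M : ℕ) : ℤ), fun M => ((hmemS M x).1 (hx M)).1, fun M M' hMM' => ?_⟩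
  have hxM : ((x M : ℕ)) = (x M' : ℕ) % ((M : ℕ+) : ℕ) := ((hmemS M' x).1 (hx M')).2 M hMM'
  change (((x M' : ℕ) : ℤ)) % (((M : ℕ+) : ℕ) : ℤ) = (((x M : ℕ) : ℤ)) % (((M : ℕ+) : ℕ) : ℤ)
  rw [hxM, Int.natCast_mod, Int.emod_emod_of_dvd _ (dvd_refl _)]

/-! ## §3. (b2) at EVERY pair from a compatible family of exponents -/

/-- **Congruent exponents give the same level-`M` reduction on ALL of `Π^tp_Ÿ̲̲`, ANY parity, under the squares hypothesis**
(the square twin of `red_conjRoot_zpow_eq_of_modEq`): if every `θ[σ⁻¹; σ⁻¹kσk⁻¹]` (`σ ∈ Π^tp_X̲̲` geometric, `k ∈ Π^tp_Ÿ̲̲`) is a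
square in `l·Δ_Θ`, then `m ≡ m′ (mod M)` ⇒ `red_M (conjRoot (a^{m′}) f k) = red_M (conjRoot (a^m) f k)` — `a^{m′} = a^m (a^t)^M`,
action law `conjRoot_mul_apply`, `red_conjRoot_pow_eq_of_sq`. [cite: MochizukiEtTh2009, Cor 2.19(iii) p.65] -/
theorem red_conjRoot_zpow_eq_of_modEq_of_sq (hC : D.Compat) (h15 : Prop15iii E hC)
    {f : contCocycles D.toTheta D.DeltaTheta C.GtpYdduu} (hf : f ∈ C.rootCocycles hC)
    (a : C.Huu) (ha : D.aug.toMonoidHom (a : D.PiTemp) = 1)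
    (hsq : ∀ σ : C.Huu, D.aug.toMonoidHom (σ : D.PiTemp) = 1 → ∀ k : C.GtpYdduu, ∃ s : D.lDeltaTheta l,
      (s : D.GtpTheta) ^ 2 = D.toTheta ((σ : D.PiTemp)⁻¹ * ((σ : D.PiTemp)⁻¹ * k * σ * (k : D.PiTemp)⁻¹) * σ *
        ((σ : D.PiTemp)⁻¹ * k * σ * (k : D.PiTemp)⁻¹)⁻¹))
    (k : C.GtpYdduu) (M : Es) {m m' : ℤ} (hmm' : m ≡ m' [ZMOD ((M : ℕ+) : ℕ)]) :
    (τ.mod M).red ⟨(C.conjRoot hC (a ^ m') f.1 k : D.GtpTheta), (D.lDeltaTheta_normal l).conj_mem _ (hf.1 _) _⟩ =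
      (τ.mod M).red ⟨(C.conjRoot hC (a ^ m) f.1 k : D.GtpTheta), (D.lDeltaTheta_normal l).conj_mem _ (hf.1 _) _⟩ := by
  obtain ⟨t, ht⟩ := (Int.modEq_iff_dvd.1 hmm')
  have hm' : m' = m + t * (((M : ℕ+) : ℕ) : ℤ) := by rw [mul_comm]; omega
  have ham : D.aug.toMonoidHom ((a ^ m : C.Huu) : D.PiTemp) = 1 := by
    rw [Subgroup.coe_zpow, map_zpow, ha, one_zpow]
  have hat : D.aug.toMonoidHom ((a ^ t : C.Huu) : D.PiTemp) = 1 := by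
    rw [Subgroup.coe_zpow, map_zpow, ha, one_zpow]
  have hdec : (a ^ m' : C.Huu) = a ^ m * (a ^ t) ^ ((M : ℕ+) : ℕ) := by
    rw [hm', zpow_add, zpow_mul, zpow_natCast]
  have key : C.conjRoot hC (a ^ m') f.1 k =
      C.conjRoot hC ((a ^ t) ^ ((M : ℕ+) : ℕ)) f.1 ⟨_, C.conj_mem_GtpYdduu hC (a ^ m) k⟩ := by
    rw [hdec, C.conjRoot_mul_apply hC]
    change MulAut.conjNormal (D.toTheta ((a ^ m : C.Huu) : D.PiTemp)) _ = _
    rw [ThetaSetting.conjNormal_eq_of_aug_eq_one ham]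
  have key' : C.conjRoot hC (a ^ m) f.1 k = f.1 ⟨_, C.conj_mem_GtpYdduu hC (a ^ m) k⟩ := by
    change MulAut.conjNormal (D.toTheta ((a ^ m : C.Huu) : D.PiTemp)) _ = _
    rw [ThetaSetting.conjNormal_eq_of_aug_eq_one ham]
  have e1 : (⟨(C.conjRoot hC (a ^ m') f.1 k : D.GtpTheta), (D.lDeltaTheta_normal l).conj_mem _ (hf.1 _) _⟩ :
      D.lDeltaTheta l) = ⟨(C.conjRoot hC ((a ^ t) ^ ((M : ℕ+) : ℕ)) f.1 ⟨_, C.conj_mem_GtpYdduu hC (a ^ m) k⟩ :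
        D.GtpTheta), (D.lDeltaTheta_normal l).conj_mem _ (hf.1 _) _⟩ := by
    apply Subtype.ext
    change ((C.conjRoot hC (a ^ m') f.1 k : D.DeltaTheta) : D.GtpTheta) =
      ((C.conjRoot hC ((a ^ t) ^ ((M : ℕ+) : ℕ)) f.1 ⟨_, C.conj_mem_GtpYdduu hC (a ^ m) k⟩ : D.DeltaTheta) : D.GtpTheta)
    rw [key]
  have e2 : (⟨(C.conjRoot hC (a ^ m) f.1 k : D.GtpTheta), (D.lDeltaTheta_normal l).conj_mem _ (hf.1 _) _⟩ :
      D.lDeltaTheta l) = ⟨(f.1 ⟨_, C.conj_mem_GtpYdduu hC (a ^ m) k⟩ : D.GtpTheta), hf.1 _⟩ := by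
    apply Subtype.ext
    change ((C.conjRoot hC (a ^ m) f.1 k : D.DeltaTheta) : D.GtpTheta) =
      ((f.1 ⟨_, C.conj_mem_GtpYdduu hC (a ^ m) k⟩ : D.DeltaTheta) : D.GtpTheta)
    rw [key']
  obtain ⟨s, hs⟩ := hsq (a ^ t) hat ⟨_, C.conj_mem_GtpYdduu hC (a ^ m) k⟩
  rw [e1, e2, C.red_conjRoot_pow_eq_of_sq τ hC h15 hf (a ^ t) hat _ M s hs]

/-- **(b2) at EVERY pair from a compatible family (square route)**: for a family `m : E → ℤ` with `m M′ ≡ m M (mod M)`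
(`M ∣ M′`) and the squares hypothesis, `red_M (conjRoot (a^{m M′}) f g̃) = red_M (conjRoot (a^{m M}) f g̃)` for every `g ∈ Π^tp_Ÿ̲̲`
and every pair — the clause (b2) of `cor219_iii_of_hearts` (p482618) for `x M := a^{m M}`. [cite: MochizukiEtTh2009, Cor 2.19(iii) p.65] -/
theorem levelCompat_of_compatible_of_sq (hC : D.Compat) (hS : D.Sec2Hyps) (h15 : Prop15iii E hC)
    {f : contCocycles D.toTheta D.DeltaTheta C.GtpYdduu} (hf : f ∈ C.rootCocycles hC)
    (a : C.Huu) (ha : D.aug.toMonoidHom (a : D.PiTemp) = 1)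
    (hsq : ∀ σ : C.Huu, D.aug.toMonoidHom (σ : D.PiTemp) = 1 → ∀ k : C.GtpYdduu, ∃ s : D.lDeltaTheta l,
      (s : D.GtpTheta) ^ 2 = D.toTheta ((σ : D.PiTemp)⁻¹ * ((σ : D.PiTemp)⁻¹ * k * σ * (k : D.PiTemp)⁻¹) * σ *
        ((σ : D.PiTemp)⁻¹ * k * σ * (k : D.PiTemp)⁻¹)⁻¹))
    (m : Es → ℤ) (hcompat : ∀ M M' : Es, ((M : ℕ+) ∣ M') → m M' ≡ m M [ZMOD ((M : ℕ+) : ℕ)])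
    (M M' : Es) (hMM' : (M : ℕ+) ∣ M') (g : (C.thetaEnvTower τ hC hS).PiYdd) :
    (τ.mod M).red ⟨(C.conjRoot hC (a ^ m M') f.1 (C.inclYdduu g) : D.GtpTheta),
        (D.lDeltaTheta_normal l).conj_mem _ (hf.1 _) _⟩ =
      (τ.mod M).red ⟨(C.conjRoot hC (a ^ m M) f.1 (C.inclYdduu g) : D.GtpTheta),
        (D.lDeltaTheta_normal l).conj_mem _ (hf.1 _) _⟩ :=
  C.red_conjRoot_zpow_eq_of_modEq_of_sq τ hC h15 hf a ha hsq (C.inclYdduu g) M (hcompat M M' hMM').symm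

/-- **(b2) from a compatible family at pairs with ODD lower level, without the squares hypothesis**
(`red_conjRoot_zpow_eq_of_modEq`). [cite: MochizukiEtTh2009, Cor 2.19(iii) p.65] -/
theorem levelCompat_of_compatible_of_odd (hC : D.Compat) (hS : D.Sec2Hyps) (h15 : Prop15iii E hC)
    {f : contCocycles D.toTheta D.DeltaTheta C.GtpYdduu} (hf : f ∈ C.rootCocycles hC)
    (a : C.Huu) (ha : D.aug.toMonoidHom (a : D.PiTemp) = 1)
    (m : Es → ℤ) (hcompat : ∀ M M' : Es, ((M : ℕ+) ∣ M') → m M' ≡ m M [ZMOD ((M : ℕ+) : ℕ)])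
    (M M' : Es) (hMM' : (M : ℕ+) ∣ M') (hodd : ¬ 2 ∣ ((M : ℕ+) : ℕ)) (g : (C.thetaEnvTower τ hC hS).PiYdd) :
    (τ.mod M).red ⟨(C.conjRoot hC (a ^ m M') f.1 (C.inclYdduu g) : D.GtpTheta),
        (D.lDeltaTheta_normal l).conj_mem _ (hf.1 _) _⟩ =
      (τ.mod M).red ⟨(C.conjRoot hC (a ^ m M) f.1 (C.inclYdduu g) : D.GtpTheta),
        (D.lDeltaTheta_normal l).conj_mem _ (hf.1 _) _⟩ :=
  C.red_conjRoot_zpow_eq_of_modEq τ hC h15 hf a ha (C.inclYdduu g) M hodd (hcompat M M' hMM').symm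


/-! ## §4. The LEVEL-DEPENDENT knit: Cor. 2.19 (iii) from hearts AT ONE POINT with exponents `∃ m` per level (no constant conjugator) -/

/-- **The per-`(γ, γ̃)` package of `cor219_iii_of_hearts` from POINT-hearts.**  Fix a root cocycle `f₀`, geometric `a ∈ Π^tp_X̲̲`,
`b ∈ Π^tp_Ÿ̲̲` with `θ⁅a⁻¹,b⁆ ∈ l·Δ_Θ`, the (D1*) density at `b`, and the squares hypothesis.  If at EVERY level `M` SOME exponent
`m` satisfies the value identity `red_M (γ̃⁻¹ f₀(γ b̃)) = red_M (conjRoot (a^m) f₀ b̃)` (the `∃ m`-shape; no compatibility asked),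
then there are points `x M := a^{m M}` (a COMPATIBLE choice, §2) with the level-wise Δ_P-hearts (b1) (abc-iut-L1-t6's
`heart_of_value_at'`, p490284, with `w := a^{m M}`) AND the level compatibility (b2) (§3). [cite: MochizukiEtTh2009, Cor 2.19 (iii) p.65] -/
theorem hearts_package_of_pointHearts_of_sq (hC : D.Compat) (hS : D.Sec2Hyps) (h15 : Prop15iii E hC)
    (a : C.Huu) (ha : D.aug.toMonoidHom (a : D.PiTemp) = 1)
    (b : (C.thetaEnvTower τ hC hS).PiYdd) (hb : D.aug.toMonoidHom ((b : C.Huu) : D.PiTemp) = 1)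
    (h₁ : D.toTheta (((a : D.PiTemp))⁻¹ * ((b : C.Huu) : D.PiTemp) * (a : D.PiTemp) * (((b : C.Huu) : D.PiTemp))⁻¹) ∈
      D.lDeltaTheta l)
    (hdense : Dense ((Subgroup.closure
        {x : ↥(D.aug.toMonoidHom.comp (C.Huu.subtype.comp ((C.thetaEnvTower τ hC hS).PiYdd).subtype)).ker |
          D.toTheta ((((x : (C.thetaEnvTower τ hC hS).PiYdd) : C.Huu)) : D.PiTemp) ∈ D.DeltaTheta ∨
            (x : (C.thetaEnvTower τ hC hS).PiYdd) = b} :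
        Subgroup ↥(D.aug.toMonoidHom.comp (C.Huu.subtype.comp ((C.thetaEnvTower τ hC hS).PiYdd).subtype)).ker) :
      Set ↥(D.aug.toMonoidHom.comp (C.Huu.subtype.comp ((C.thetaEnvTower τ hC hS).PiYdd).subtype)).ker))
    (hsq : ∀ σ : C.Huu, D.aug.toMonoidHom (σ : D.PiTemp) = 1 → ∀ k : C.GtpYdduu, ∃ s : D.lDeltaTheta l,
      (s : D.GtpTheta) ^ 2 = D.toTheta ((σ : D.PiTemp)⁻¹ * ((σ : D.PiTemp)⁻¹ * k * σ * (k : D.PiTemp)⁻¹) * σ *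
        ((σ : D.PiTemp)⁻¹ * k * σ * (k : D.PiTemp)⁻¹)⁻¹))
    (γ : (C.thetaEnvTower τ hC hS).PiX ≃ₜ* (C.thetaEnvTower τ hC hS).PiX)
    (hγ : (C.thetaEnvTower τ hC hS).PiYdd.map γ.toMulEquiv.toMonoidHom = (C.thetaEnvTower τ hC hS).PiYdd)
    (γμ : ∀ M : Es, (C.thetaEnvTower τ hC hS).mu M ≃* (C.thetaEnvTower τ hC hS).mu M)
    (hcompat : ∀ (M : Es) (g : (C.thetaEnvTower τ hC hS).lDeltaTheta) (hg : γ g ∈ (C.thetaEnvTower τ hC hS).lDeltaTheta),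
      (C.thetaEnvTower τ hC hS).thetaMod M ⟨γ g, hg⟩ = γμ M ((C.thetaEnvTower τ hC hS).thetaMod M g))
    (hL : (C.thetaEnvTower τ hC hS).lDeltaTheta.map γ.toMulEquiv.toMonoidHom = (C.thetaEnvTower τ hC hS).lDeltaTheta)
    (γΛ : D.lDeltaTheta l ≃* D.lDeltaTheta l)
    (hγΛ : ∀ (g : (C.thetaEnvTower τ hC hS).lDeltaTheta) (hg : γ g ∈ (C.thetaEnvTower τ hC hS).lDeltaTheta),
      C.toLDelta ⟨γ g, hg⟩ = γΛ (C.toLDelta g))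
    {f₀ : contCocycles D.toTheta D.DeltaTheta C.GtpYdduu} (hf₀ : f₀ ∈ C.rootCocycles hC)
    (hex : ∀ M : Es, ∃ m : ℤ,
      (τ.mod M).red (γΛ.symm ⟨(f₀.1 (C.inclYdduu ⟨γ b, C.apply_mem_PiYdd τ hC hS γ hγ b⟩) : D.GtpTheta), hf₀.1 _⟩) =
        (τ.mod M).red ⟨(C.conjRoot hC (a ^ m) f₀.1 (C.inclYdduu b) : D.GtpTheta),
          (D.lDeltaTheta_normal l).conj_mem _ (hf₀.1 _) _⟩) :
    ∃ x : Es → (C.thetaEnvTower τ hC hS).PiX,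
      (∀ (M : Es) (g : (C.thetaEnvTower τ hC hS).PiYdd), D.aug.toMonoidHom ((g : C.Huu) : D.PiTemp) = 1 →
        (τ.mod M).red (γΛ.symm ⟨(f₀.1 (C.inclYdduu ⟨γ g, C.apply_mem_PiYdd τ hC hS γ hγ g⟩) : D.GtpTheta),
          hf₀.1 _⟩) =
          (τ.mod M).red ⟨(C.conjRoot hC (x M) f₀.1 (C.inclYdduu g) : D.GtpTheta),
            (D.lDeltaTheta_normal l).conj_mem _ (hf₀.1 _) _⟩) ∧
      (∀ (M M' : Es), ((M : ℕ+) ∣ M') → ∀ g : (C.thetaEnvTower τ hC hS).PiYdd,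
        (τ.mod M).red ⟨(C.conjRoot hC (x M') f₀.1 (C.inclYdduu g) : D.GtpTheta),
            (D.lDeltaTheta_normal l).conj_mem _ (hf₀.1 _) _⟩ =
          (τ.mod M).red ⟨(C.conjRoot hC (x M) f₀.1 (C.inclYdduu g) : D.GtpTheta),
            (D.lDeltaTheta_normal l).conj_mem _ (hf₀.1 _) _⟩) := by
  -- a COMPATIBLE choice of exponents (§2)
  obtain ⟨m, hmV, hmc⟩ := C.exists_compatible_exponents τ hC hS h15 hf₀ a ha b hb h₁
    (γΛ.symm ⟨(f₀.1 (C.inclYdduu ⟨γ b, C.apply_mem_PiYdd τ hC hS γ hγ b⟩) : D.GtpTheta), hf₀.1 _⟩) hex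
  refine ⟨fun M => a ^ m M, fun M g hg => ?_, fun M M' hMM' g => ?_⟩
  · -- (b1): the transport `F = Φ_γ f₀` and the Δ_P-heart at level `M` from the value at `b` (p490284 `heart_of_value_at'`)
    obtain ⟨F, hF, hFmul, hFc⟩ := C.exists_transport τ hC hS γ hγ hL γΛ hγΛ f₀ hf₀.1
    have hvalF : (τ.mod M).red (F (C.inclYdduu b)) =
        (τ.mod M).red ⟨(C.conjRoot hC (a ^ m M) f₀.1 (C.inclYdduu b) : D.GtpTheta),
          (D.lDeltaTheta_normal l).conj_mem _ (hf₀.1 _) _⟩ := by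
      rw [hF b]; exact hmV M
    have hheart := C.heart_of_value_at' τ hC hS h15 γ hγ hL γΛ hγΛ M (γμ M) hf₀ F hF hFmul (hFc M (γμ M) (hcompat M))
      (a ^ m M) b (C.uniqueness_on_DeltaP_of_dense τ hC hS M b hdense) hvalF g hg
    rw [hF g] at hheart
    exact hheart
  · -- (b2): §3
    exact C.levelCompat_of_compatible_of_sq τ hC hS h15 hf₀ a ha hsq m hmc M M' hMM' g

/-- **Cor. 2.19 (iii) (tower form) at an origin from POINT-hearts with LEVEL-DEPENDENT conjugators `a^{m_M}`** — the knit of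
abc-iut-C-hgal-2's `cor219_iii_of_hearts_of_origin` (p482618) on the route where the conjugator is NOT constant in the level:
HYPOTHESES as in abc-iut-L1-t6's `cor219_iii_of_const_conjugator_of_origin` (p490284) except that the constant-`w` value clause is
REPLACED by the weaker «for every induced `γ̃`, some root cocycle `f₀` such that at EVERY level `M` SOME power `a^m` of the fixed
geometric `a` satisfies `red_M (γ̃⁻¹ f₀(γ b̃)) = red_M (conjRoot (a^m) f₀ b̃)`» (exponent allowed to depend on `M`, NO
compatibility asked), plus `b` geometric, `θ⁅a⁻¹,b⁆ ∈ l·Δ_Θ`, and the squares hypothesis on geometric commutators (at the Tate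
model: p487040 `exists_sq_eq_toTheta_comm_modelχq`).  PROOF: `hearts_package_of_pointHearts_of_sq` (compatible choice by
compactness §2, hearts by `heart_of_value_at'`, (b2) by the quadratic law / square vanishing §3) fed to p482618.
[cite: MochizukiEtTh2009, Cor 2.19 (iii) p.65] -/
theorem cor219_iii_of_pointHearts_of_sq_of_origin (hO : D.IsEtThOrigin) (hC : D.Compat) (hS : D.Sec2Hyps)
    (h15 : Prop15iii E hC)
    (hopen : IsOpenMap fun g : (C.thetaEnvTower τ hC hS).PiYdd =>
      (C.thetaEnvTower τ hC hS).aug (g : (C.thetaEnvTower τ hC hS).PiX))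
    (a : C.Huu) (ha : D.aug.toMonoidHom (a : D.PiTemp) = 1)
    (b : (C.thetaEnvTower τ hC hS).PiYdd) (hb : D.aug.toMonoidHom ((b : C.Huu) : D.PiTemp) = 1)
    (h₁ : D.toTheta (((a : D.PiTemp))⁻¹ * ((b : C.Huu) : D.PiTemp) * (a : D.PiTemp) * (((b : C.Huu) : D.PiTemp))⁻¹) ∈
      D.lDeltaTheta l)
    (hdense : Dense ((Subgroup.closure
        {x : ↥(D.aug.toMonoidHom.comp (C.Huu.subtype.comp ((C.thetaEnvTower τ hC hS).PiYdd).subtype)).ker |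
          D.toTheta ((((x : (C.thetaEnvTower τ hC hS).PiYdd) : C.Huu)) : D.PiTemp) ∈ D.DeltaTheta ∨
            (x : (C.thetaEnvTower τ hC hS).PiYdd) = b} :
        Subgroup ↥(D.aug.toMonoidHom.comp (C.Huu.subtype.comp ((C.thetaEnvTower τ hC hS).PiYdd).subtype)).ker) :
      Set ↥(D.aug.toMonoidHom.comp (C.Huu.subtype.comp ((C.thetaEnvTower τ hC hS).PiYdd).subtype)).ker))
    (hsq : ∀ σ : C.Huu, D.aug.toMonoidHom (σ : D.PiTemp) = 1 → ∀ k : C.GtpYdduu, ∃ s : D.lDeltaTheta l,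
      (s : D.GtpTheta) ^ 2 = D.toTheta ((σ : D.PiTemp)⁻¹ * ((σ : D.PiTemp)⁻¹ * k * σ * (k : D.PiTemp)⁻¹) * σ *
        ((σ : D.PiTemp)⁻¹ * k * σ * (k : D.PiTemp)⁻¹)⁻¹))
    (H : ∀ (γ : (C.thetaEnvTower τ hC hS).PiX ≃ₜ* (C.thetaEnvTower τ hC hS).PiX)
      (hγ : (C.thetaEnvTower τ hC hS).PiYdd.map γ.toMulEquiv.toMonoidHom = (C.thetaEnvTower τ hC hS).PiYdd)
      (γμ : ∀ M : Es, (C.thetaEnvTower τ hC hS).mu M ≃* (C.thetaEnvTower τ hC hS).mu M)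
      (_ : ∀ (M : Es) (g : (C.thetaEnvTower τ hC hS).lDeltaTheta) (hg : γ g ∈ (C.thetaEnvTower τ hC hS).lDeltaTheta),
        (C.thetaEnvTower τ hC hS).thetaMod M ⟨γ g, hg⟩ = γμ M ((C.thetaEnvTower τ hC hS).thetaMod M g)),
      (D.toTheta.comp C.Huu.subtype).ker.map γ.toMulEquiv.toMonoidHom = (D.toTheta.comp C.Huu.subtype).ker ∧
      (C.thetaEnvTower τ hC hS).lDeltaTheta.map γ.toMulEquiv.toMonoidHom = (C.thetaEnvTower τ hC hS).lDeltaTheta ∧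
      ∀ (γΛ : D.lDeltaTheta l ≃* D.lDeltaTheta l)
        (_ : ∀ (g : (C.thetaEnvTower τ hC hS).lDeltaTheta) (hg : γ g ∈ (C.thetaEnvTower τ hC hS).lDeltaTheta),
          C.toLDelta ⟨γ g, hg⟩ = γΛ (C.toLDelta g)),
        ∃ (f₀ : contCocycles D.toTheta D.DeltaTheta C.GtpYdduu) (hf₀ : f₀ ∈ C.rootCocycles hC),
          ∀ M : Es, ∃ m : ℤ,
            (τ.mod M).red (γΛ.symm ⟨(f₀.1 (C.inclYdduu ⟨γ b, C.apply_mem_PiYdd τ hC hS γ hγ b⟩) : D.GtpTheta),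
              hf₀.1 _⟩) =
              (τ.mod M).red ⟨(C.conjRoot hC (a ^ m) f₀.1 (C.inclYdduu b) : D.GtpTheta),
                (D.lDeltaTheta_normal l).conj_mem _ (hf₀.1 _) _⟩) :
    (C.thetaEnvTower τ hC hS).Cor219_iii := by
  refine C.cor219_iii_of_hearts_of_origin τ hO hC hS hopen fun γ hγ γμ hcompat => ?_
  obtain ⟨hker, hL, hrest⟩ := H γ hγ γμ hcompat
  refine ⟨hker, hL, fun γΛ hγΛ => ?_⟩
  obtain ⟨f₀, hf₀, hex⟩ := hrest γΛ hγΛ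
  obtain ⟨x, hx1, hx2⟩ := C.hearts_package_of_pointHearts_of_sq τ hC hS h15 a ha b hb h₁ hdense hsq γ hγ γμ hcompat hL
    γΛ hγΛ hf₀ hex
  exact ⟨f₀, hf₀, x, hx1, hx2⟩

end ThetaSetting.EtaleThetaData.DoubleUnderline

end Literature.AnabelianGeometry.EtaleTheta

end
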